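import Mathlib

/-!
# Sketch — first lemmas of the crux-idea lines for `ConvexGribovBody.BrascampLiebVacuum`
(crux item stmt-QuantumFields-8779). Statements only (`sorry`); they must elaborate.
-/

open scoped InnerProductSpace BigOperators
open MeasureTheory Filter Topology

namespace Summit.QuantumFields.YangMills.Cruxes.BrascampLiebVacuum.Sketch

/-- **Card `rp-square-root-transfer`, first lemma (abstract RP square root, Falk–Bruch /
Cauchy–Schwarz in the spectral measure).** For a symmetric operator `T` with `0 ≤ T` and
`‖T‖ < 1` on a finite-dimensional real inner product space and any vector `v`,
`‖v‖⁴ ≤ ⟪v, v - T v⟫ · Σ_{t ∈ ℤ} ⟪v, T^{|t|} v⟫`, the two-sided sum written as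
`2 Σ_{t ∈ ℕ} ⟪v, Tᵗ v⟫ - ‖v‖²`. In the application `T` is the (normalised, positive by reflection
positivity) transfer matrix on the orthocomplement of the vacuum, `v = (f - 𝔼 f) Ω`, the first
factor is half the one-step quadratic variation `𝔼 (f - τ₁ f)²` and the second the time
susceptibility `Σ_t Cov(f, τ_t f)`. Equality up to the factor `1 + r` on a single mode. -/
theorem normSq_sq_le_oneStep_mul_susceptibility {n : ℕ}
    (T : EuclideanSpace ℝ (Fin n) →L[ℝ] EuclideanSpace ℝ (Fin n))
    (hT : (T : EuclideanSpace ℝ (Fin n) →ₗ[ℝ] EuclideanSpace ℝ (Fin n)).IsSymmetric)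
    (hpos : ∀ v, 0 ≤ ⟪v, T v⟫_ℝ) (hlt : ‖T‖ < 1) (v : EuclideanSpace ℝ (Fin n)) :
    ‖v‖ ^ 4 ≤ ⟪v, v - T v⟫_ℝ * (2 * (∑' t : ℕ, ⟪v, (T ^ t) v⟫_ℝ) - ‖v‖ ^ 2) := by
  sorry

/-- **(NOT FILED — lever coincides with the other ideator's card `dynamical-cramer-rao`; kept as a record.)
Card `witten-one-form-delocalisation`, first lemma (flat toy of the one-form criterion:
integrated Bakry–Émery on vector fields ⇒ Poincaré; Helffer–Sjöstrand).** Let `μ = e^{-H} dx` be a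
probability measure on `ℝⁿ` with `H ∈ C²` and bounded Hessian. If the deformed quadratic form of
the one-form Witten Laplacian, `ω ↦ ∫ (‖∇ω‖²_HS + ⟪ω, Hess H ω⟫) dμ`, is bounded below by
`lam ∫ ‖ω‖² dμ` on compactly supported `C¹` vector fields (pointwise convexity NOT assumed), then
`Var_μ f ≤ lam⁻¹ ∫ ‖∇f‖² dμ`. The line applies the analogue on the compact group product `G^E`
(with the Ricci term of the bi-invariant metric) to the explicit four-dimensional Wilson measure. -/
theorem poincare_of_oneForm_lowerBound {n : ℕ} (H : EuclideanSpace ℝ (Fin n) → ℝ)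
    (hH : ContDiff ℝ 2 H) (hHess : ∃ M : ℝ, ∀ x, ‖fderiv ℝ (gradient H) x‖ ≤ M)
    (hprob : IsProbabilityMeasure ((volume : Measure (EuclideanSpace ℝ (Fin n))).withDensity
      fun x => ENNReal.ofReal (Real.exp (-H x))))
    (lam : ℝ) (hlam : 0 < lam)
    (hform : ∀ ω : EuclideanSpace ℝ (Fin n) → EuclideanSpace ℝ (Fin n), ContDiff ℝ 1 ω →
      HasCompactSupport ω →
      lam * ∫ x, ‖ω x‖ ^ 2
          ∂((volume : Measure (EuclideanSpace ℝ (Fin n))).withDensity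
            fun x => ENNReal.ofReal (Real.exp (-H x))) ≤
        ∫ x, ((∑ i, ‖fderiv ℝ ω x (EuclideanSpace.single i (1 : ℝ))‖ ^ 2) +
            ⟪ω x, fderiv ℝ (gradient H) x (ω x)⟫_ℝ)
          ∂((volume : Measure (EuclideanSpace ℝ (Fin n))).withDensity
            fun x => ENNReal.ofReal (Real.exp (-H x))))
    (f : EuclideanSpace ℝ (Fin n) → ℝ) (hf : ContDiff ℝ 1 f) (hfc : HasCompactSupport f) :
    let μ : Measure (EuclideanSpace ℝ (Fin n)) :=
      (volume : Measure (EuclideanSpace ℝ (Fin n))).withDensity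
        fun x => ENNReal.ofReal (Real.exp (-H x))
    ∫ x, (f x - ∫ y, f y ∂μ) ^ 2 ∂μ ≤ lam⁻¹ * ∫ x, ‖gradient f x‖ ^ 2 ∂μ := by
  sorry

/-- **Card `per-scale-brascamp-lieb`, first lemma (block-averaging variance martingale with a
Dirichlet-form PARTITION across scales ⇒ Poincaré with the WORST single-scale constant; Lu–Yau shape).**
Along a decreasing family of σ-algebras `m 0 = mΩ ≥ m 1 ≥ … ≥ m K` (covariant block averages of the
t = 0 links at dyadic scales), suppose: for `k < K` every `m k`-measurable `g` satisfies the integrated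
CONDITIONAL Poincaré inequality `E (g - E[g | m (k+1)])² ≤ κ k · Γ k g` with the scale-`k` Dirichlet form
`Γ k ≥ 0`; the coarsest law satisfies `Var g ≤ κ K · Γ K g`; and the scale forms of the martingale
PARTITION the total form, `Σ_{k ≤ K} Γ k (E[f | m k]) ≤ A · Γtot f`. Then
`Var f ≤ κmax · A · Γtot f` for any common bound `κ k ≤ κmax`: no sum over scales appears, so it
suffices that EVERY single-scale conditional constant is `≤ C₁ ·` (its own band covariance) `≤ C₁c₂ · Dmax`.
(Proof: orthogonality of martingale differences + tower property; bookkeeping only.) -/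
theorem variance_le_max_condPoincare {Ω : Type*} {mΩ : MeasurableSpace Ω} (μ : Measure Ω)
    [IsProbabilityMeasure μ] (K : ℕ) (m : ℕ → MeasurableSpace Ω) (hm : ∀ k, m k ≤ mΩ)
    (hmono : Antitone m) (hm0 : m 0 = mΩ)
    (Γ : ℕ → (Ω → ℝ) → ℝ) (Γtot : (Ω → ℝ) → ℝ) (κ : ℕ → ℝ) (κmax A : ℝ)
    (hΓ : ∀ k g, 0 ≤ Γ k g)
    (hcond : ∀ k < K, ∀ g : Ω → ℝ, Measurable[m k] g → MemLp g 2 μ →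
      ∫ ω, (g ω - (μ[g|m (k + 1)]) ω) ^ 2 ∂μ ≤ κ k * Γ k g)
    (hlast : ∀ g : Ω → ℝ, Measurable[m K] g → MemLp g 2 μ →
      ∫ ω, (g ω - ∫ ω', g ω' ∂μ) ^ 2 ∂μ ≤ κ K * Γ K g)
    (hpartition : ∀ f : Ω → ℝ, MemLp f 2 μ →
      ∑ k ∈ Finset.range (K + 1), Γ k (μ[f|m k]) ≤ A * Γtot f)
    (hκ : ∀ k ≤ K, κ k ≤ κmax) (hκ0 : 0 ≤ κmax) (f : Ω → ℝ) (hf : MemLp f 2 μ) :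
    ∫ ω, (f ω - ∫ ω', f ω' ∂μ) ^ 2 ∂μ ≤ κmax * A * Γtot f := by
  sorry

end Summit.QuantumFields.YangMills.Cruxes.BrascampLiebVacuum.Sketch
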